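import Summits.CriticalPhenomena.SAWScalingLimit.Theses.SAWRenewalTightness

/-!
# Line `bridge-doubling-tower` for crux `SAWRenewalTightness.TubeLowerBound` (stmt-CriticalPhenomena-4730)

Planner skeleton (crux-plan, round 1; idea `bridge-doubling-tower`, triage r1-1: pass with objections O1, O2).

THE LINE. `TubeLowerBound` (pointwise polynomial lower bound `c ℓ^{-C}` for the `x_c`-mass of SAWs
`u → v` confined to the `(ℓ/10+2)`-tube of the segment `[u,v]`, ALL directions `v - u`) is reduced to ONE
transversally averaged, one-directional floor (S1) by two unconditional lemmas:

* S1 `stub_wedgeSlabFloor` (OPEN, hardest — the RSW-type input): for every span `l ≥ 1` the `x_c`-mass of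
  `e₁`-bridges of span `l` from the origin that stay in the START WEDGE `|y| < x` and in the tube `5|y| ≤ l`,
  endpoint FREE on the line `x = l`, is `≥ c l^{-C}`.
* S2 `stub_doublingUpgrade` (provable now, M): S1 ⇒ pointwise polynomial floor for DIAMOND PIECES of every
  span `s ≥ 1`: SAWs `0 → (s,0)` whose interior points satisfy `|y| < min(x, s-x)` (both wedges) and
  `10|y| ≤ s`. Mechanism = Madras–Slade Lemma 4.1.12 (reflect-and-Schwarz doubling, book p.85): a wedge
  bridge `0 → (l,y)`, one step `e₁`, and the mirror image in `x = l + 1/2` of a second wedge bridge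
  `0 → (l,y)` form a diamond piece `0 → (2l+1,0)`; pairing equal endpoint heights and Cauchy–Schwarz over
  the `2⌊l/5⌋+1` heights give `h(2l+1+e) ≥ x_c^{1+e} F(l)² / (2⌊l/5⌋+1)` (`e ∈ {0,1}`: one more `e₁` step
  for even spans), hence `h(s) ≥ x_c² c² s^{-(2C+1)}`. The start wedge of the INPUT is exactly what makes
  the mirrored half satisfy the end wedge (answer to triage O1: corners below are free BECAUSE of it).
* S3 `stub_diamondStaircase` (provable now, M–L): diamond-piece floor ⇒ all-direction tube floor in the
  intrinsic form `c (max 1 |u-v|)^{-C}` with tube half-width `|u-v|/10 + 2`. Mechanism (the corner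
  mechanism asked for by O1): for `v - u = (a,b)` concatenate `m = 6` horizontal and `6` vertical diamond
  pieces of spans `⌊ja/6⌋-⌊(j-1)a/6⌋`, `⌊jb/6⌋-⌊(j-1)b/6⌋` along the lattice staircase through the points
  `(⌊ja/6⌋, ⌊jb/6⌋)` of the segment. SELF-AVOIDANCE IS FREE: with `φ = sgn(a)·x + sgn(b)·y`, the strict
  wedges put the interior of every piece in the OPEN `φ`-slab between its two corners (horizontal piece
  from `(x₀,y₀)` to `(x₁,y₀)`: `|y-y₀| < min(x-x₀, x₁-x)` ⇒ `φ(x₀,y₀) < φ < φ(x₁,y₀)`; same for vertical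
  pieces), the corners have non-decreasing `φ` (equal only across empty pieces), so the `12` interiors and
  the corners are pairwise disjoint, the concatenation is a SAW visiting each corner once (injectivity), and
  its mass is `≥ ∏ h(s_j) h(t_j) ≥ c^{12} (|u-v|+1)^{-12C}`; the staircase deviates from `[u,v]` by
  `≤ |u-v|(1/12 + 1/60) + 1.52 ≤ |u-v|/10 + 2`. Vertical / reversed pieces come from the `e₁`-pieces by
  the lattice symmetries `(x,y) ↦ (±x,±y), (y,x)` (`SAW.Zd.reflAt`, `zdGraph_adj_neg`). Toy checks of S2's
  injection inequality and of S3's disjointness/tube/injectivity by exact enumeration: planner folder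
  `toy/wedge_doubling.py`, `toy/staircase_check2.py` (0 violations).
* `TubeLowerBound_of` (proved here): the intrinsic form ⇒ the crux (monotonicity of the tube in `ℓ` and of
  `ℓ ↦ ℓ^{-C}`, `C ≥ 0`).

Every stub is stated over TREE VOCABULARY ONLY (`SAW.Zd.saws`, `SAW.Zd.sawFun`, `SAW.criticalFugacity`,
`Site.toComplex`; no local `def`), so each lands verbatim as
`Summits/CriticalPhenomena/SAWScalingLimit/Theorems/SAWRenewalTightnessTubeLowerBound<Stub>.lean`
(`--supports stmt-CriticalPhenomena-4730`) without importing this workfile.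

Disproof.lean: none published for this crux at planning time (`ledger crux ls`: only TRIAGE-r1-1.md) — no
`_false_without_` obligations to honour yet; negatives index (CriticalPhenomena): nothing on bridge /
renewal / tube floors.
-/

namespace Summit.CriticalPhenomena.SAWScalingLimit.Cruxes.TubeLowerBound.BridgeDoublingTower

open scoped BigOperators Classical
open Literature.Probability.LatticeModels Literature.Probability.RandomPlanarGeometry
open Summit.CriticalPhenomena.SAWScalingLimit.Theses.SAWRenewalTightness (TubeLowerBound)

/-! ## The stubs -/

/-- **S1 — WEDGE-SLAB AVERAGED FLOOR (the RSW-type input; OPEN, hardest stub).**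
There are `C ≥ 0`, `c > 0` such that for every span `l ≥ 1` the `x_c`-mass of self-avoiding walks `ω`
from `0` with `ω(n) ` on the line `x = l` (endpoint height FREE), which are `e₁`-bridges of span `l`
(`0 < x ≤ l` after time `0`) staying in the start wedge `|y| < x` (all times `≥ 1`) and in the tube
`5|y| ≤ l` (all times), is at least `c l^{-C}` (some partial sum in the length already exceeds it).
The `T = ∞`, wedge-free shadow is Kesten's span-renewal floor `u_l ≥ l^{-C}` (Madras–Slade (4.2.9)–(4.2.12)
at `z = z_c`; even `u_l → 0` has "no known proof", book p.92) — the meeting point with line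
`subcritical-renewal-floor`. Heuristic value `≍ l^{-ρ}`, `ρ` = cone(90°)+line exponents of SLE_{8/3};
aspect ratio 5 costs a constant. Why it might fail: no RSW/lower-bound technology for `x_c`-SAW on `ℤ²`
(Madras–Slade p.259: no bound `q_N ≥ const N^{-p} μ^N` known); hex only via the parafermion. -/
theorem stub_wedgeSlabFloor :
    ∃ C c : ℝ, 0 ≤ C ∧ 0 < c ∧ ∀ l : ℕ, 1 ≤ l → ∃ N : ℕ,
      c * (l : ℝ) ^ (-C) ≤
        ∑ n ∈ Finset.range (N + 1),
          ∑ _ω ∈ (SAW.Zd.saws 2 n).filter (fun ω =>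
              ω n 0 = (l : ℤ) ∧
              (∀ i, 1 ≤ i → i ≤ n → |ω i 1| < ω i 0 ∧ ω i 0 ≤ (l : ℤ)) ∧
              (∀ i ≤ n, 5 * |ω i 1| ≤ (l : ℤ))),
            SAW.criticalFugacity ^ n := by
  sorry

/-- **S2 — DOUBLING UPGRADE: averaged wedge-slab floor ⇒ pointwise diamond-piece floor (provable now, M).**
If S1's conclusion holds then there are `C' ≥ 0`, `c' > 0` such that for every span `s ≥ 1` the
`x_c`-mass of DIAMOND PIECES of span `s` — self-avoiding walks `0 → (s, 0)` whose points at times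
`1 ≤ i < n` satisfy `|y| < x` and `|y| < s - x`, and all of whose points satisfy `10|y| ≤ s` — is at least
`c' s^{-C'}` (expected `C' = 2C+1`, `c' = x_c² min(c,1)²`).
Proof route (Madras–Slade 1993 Lemma 4.1.12, p.85, "reflect-and-Schwarz"): for `l ≥ 1` and wedge bridges
`ω, ω'` of span `l` (S1's family) with the SAME endpoint `(l, y)`, the walk `ω`, then the step
`(l,y) → (l+1,y)`, then the reversed mirror image of `ω'` in the line `x = l + 1/2`
(`(x',y') ↦ (2l+1-x', y')`; tree: `SAW.Zd.reflAt 0 (2l+1)`, `SAW.Zd.concatWalk`, `concatWalk_mem_saws`) is a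
diamond piece of span `2l+1` (the start wedge `|y'| < x'` of `ω'` becomes the end wedge
`|y| < 2l+1-x`; halves live in the slabs `x ≤ l`, `x ≥ l+1`; tube `5|y| ≤ l ⇒ 10|y| ≤ 2l+1`), injectively
in `(ω, ω')`; appending one more `e₁` step gives span `2l+2`. Hence, with `F(l)` = S1's sum and
`a_y` its part with endpoint height `y` (`|y| ≤ ⌊l/5⌋`):
`h(2l+1+e) ≥ x_c^{1+e} Σ_y a_y² ≥ x_c^{1+e} F(l)²/(2⌊l/5⌋+1) ≥ x_c² c² l^{-2C}/l ≥ x_c² c² s^{-(2C+1)}`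
(`2⌊l/5⌋+1 ≤ l ≤ s`); spans `s = 1, 2`: the straight walk (`SAW.Zd.straightWalk`). Toy check of the
inequality by exact enumeration: triage r1-1 (T = 1,2, spans ≤ 9, kit j007598), ratio true/bound 1.7–2.6. -/
theorem stub_doublingUpgrade :
    (∃ C c : ℝ, 0 ≤ C ∧ 0 < c ∧ ∀ l : ℕ, 1 ≤ l → ∃ N : ℕ,
      c * (l : ℝ) ^ (-C) ≤
        ∑ n ∈ Finset.range (N + 1),
          ∑ _ω ∈ (SAW.Zd.saws 2 n).filter (fun ω =>
              ω n 0 = (l : ℤ) ∧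
              (∀ i, 1 ≤ i → i ≤ n → |ω i 1| < ω i 0 ∧ ω i 0 ≤ (l : ℤ)) ∧
              (∀ i ≤ n, 5 * |ω i 1| ≤ (l : ℤ))),
            SAW.criticalFugacity ^ n) →
    ∃ C c : ℝ, 0 ≤ C ∧ 0 < c ∧ ∀ s : ℕ, 1 ≤ s → ∃ N : ℕ,
      c * (s : ℝ) ^ (-C) ≤
        ∑ n ∈ Finset.range (N + 1),
          ∑ _ω ∈ (SAW.Zd.saws 2 n).filter (fun ω =>
              ω n 0 = (s : ℤ) ∧ ω n 1 = 0 ∧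
              (∀ i, 1 ≤ i → i < n → |ω i 1| < ω i 0 ∧ |ω i 1| < (s : ℤ) - ω i 0) ∧
              (∀ i ≤ n, 10 * |ω i 1| ≤ (s : ℤ))),
            SAW.criticalFugacity ^ n := by
  sorry

/-- **S3 — DIAMOND STAIRCASE: pointwise axis-piece floor ⇒ pointwise tube floor in ALL directions
(the corner mechanism; provable now, M–L).**
If diamond pieces of every span `s ≥ 1` have `x_c`-mass `≥ c s^{-C}` (S2's conclusion), then there are
`C' ≥ 0`, `c' > 0` such that for all `u, v ∈ ℤ²` the `x_c`-mass of self-avoiding walks `u → v` all of whose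
vertices lie within distance `|u-v|/10 + 2` of the segment `[u,v]` is `≥ c' (max 1 |u-v|)^{-C'}` (expected
`C' = 12C`, `c' = min(c,1)^{12} 2^{-12C}`).
Proof route: WLOG `u = 0` (the sums are translation invariant by construction). Write `v = (a,b)`; with
`m = 6`, `S_j = ⌊ja/m⌋`, `T_j = ⌊jb/m⌋` (`j = 0..m`; for negative `a`/`b` use the mirrored pieces), follow the
lattice staircase `p₀ = 0, p₁ = (S₁,0), p₂ = (S₁,T₁), p₃ = (S₂,T₁), …, p₂ₘ = (a,b)`, inserting a horizontal
diamond piece of span `s_j = S_j - S_{j-1}` and a vertical one of span `t_j = T_j - T_{j-1}` (vertical /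
leftward / downward pieces = images of `e₁`-pieces under `(x,y) ↦ (y,x)`, `(x,y) ↦ (-x,y)`, `(x,y) ↦ (x,-y)`,
lattice isometries fixing `0`: `SAW.Zd.reflAt`, `zdGraph_adj_reflAt`, `zdGraph_adj_neg`; empty piece when
the span is `0`). DISJOINTNESS (one line): put `φ(x,y) = sgn(a)·x + sgn(b)·y`; the strict wedges
place every INTERIOR point of a piece strictly inside the open `φ`-slab between its two corners
(horizontal piece `(x₀,y₀) → (x₁,y₀)`, `x₀ < x₁`: `|y-y₀| < min(x-x₀, x₁-x)` gives
`x₀+y₀ < x+y < x₁+y₀`, i.e. `φ(p_{k-1}) < φ < φ(p_k)`; vertical pieces likewise), and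
`φ(p₀) ≤ φ(p₁) ≤ … ≤ φ(p₂ₘ)` with equality exactly across empty pieces; hence the `2m` interiors and
the distinct corners are pairwise disjoint (equivalently: at a corner `(x₁,y₀)` a point of the incoming
horizontal piece has `|y-y₀| < x₁-x` and a point of the outgoing vertical piece has `|x-x₁| < y-y₀`,
incompatible). So `SAW.Zd.concatWalk` of the `2m` pieces is in `sawFun 2 n (v-u)`
(`concatWalk_mem_saws`, separation hypothesis from the slabs), every corner is visited exactly once,
cutting at the corners inverts the map (injective on `2m`-tuples of pieces), and the mass is
`≥ ∏ h(s_j) ∏ h(t_j) ≥ (c (|a|/6+1)^{-C})^{6} (c (|b|/6+1)^{-C})^{6}` (`h(0) = 1 ≥ c` needs `c ≤ 1`: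
use `min c 1`).
TUBE: `p₂ⱼ` is within `√2` of the point `(ja/m, jb/m)` of the segment, `p₂ⱼ₋₁` within
`|ab|/(m|v|) + √2 ≤ |v|/(2m) + √2`; distance to a segment is convex along the axis-parallel legs, and a
piece deviates from its leg by `≤ span/10 ≤ |v|/(10m) + 1/10`; total `≤ 0.1|v| + 1.52 ≤ |v|/10 + 2` for
`m = 6`. `u = v`: the 0-step walk gives mass `1 ≥ c'`. Lengths: `N` = sum of the pieces' `N`'s. -/
theorem stub_diamondStaircase :
    (∃ C c : ℝ, 0 ≤ C ∧ 0 < c ∧ ∀ s : ℕ, 1 ≤ s → ∃ N : ℕ,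
      c * (s : ℝ) ^ (-C) ≤
        ∑ n ∈ Finset.range (N + 1),
          ∑ _ω ∈ (SAW.Zd.saws 2 n).filter (fun ω =>
              ω n 0 = (s : ℤ) ∧ ω n 1 = 0 ∧
              (∀ i, 1 ≤ i → i < n → |ω i 1| < ω i 0 ∧ |ω i 1| < (s : ℤ) - ω i 0) ∧
              (∀ i ≤ n, 10 * |ω i 1| ≤ (s : ℤ))),
            SAW.criticalFugacity ^ n) →
    ∃ C c : ℝ, 0 ≤ C ∧ 0 < c ∧ ∀ u v : Site 2, ∃ N : ℕ,
      c * (max 1 (dist (Site.toComplex u) (Site.toComplex v))) ^ (-C) ≤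
        ∑ n ∈ Finset.range (N + 1),
          ∑ _ω ∈ (SAW.Zd.sawFun 2 n (v - u)).filter (fun ω => ∀ i ≤ n,
              Metric.infDist (Site.toComplex (u + ω i))
                (segment ℝ (Site.toComplex u) (Site.toComplex v)) ≤
                dist (Site.toComplex u) (Site.toComplex v) / 10 + 2),
            SAW.criticalFugacity ^ n := by
  sorry

/-! ## The composition -/

/-- `x_c = 1/μ > 0`. [folklore] -/
theorem criticalFugacity_pos : 0 < SAW.criticalFugacity := by
  have h := SAW.Zd.connectiveConstant_pos 2
  rw [SAW.Zd.connectiveConstant_two] at h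
  unfold SAW.criticalFugacity
  exact inv_pos.2 h

/-- **Composition**: S1 → S2 → S3 give the intrinsic floor `c (max 1 |u-v|)^{-C}` for the `(|u-v|/10+2)`-tube;
for `ℓ ≥ max(1, |u-v|)` the `(ℓ/10+2)`-tube is larger and `ℓ^{-C} ≤ (max 1 |u-v|)^{-C}` (`C ≥ 0`), which is
`TubeLowerBound` BY NAME. -/
theorem TubeLowerBound_of : TubeLowerBound := by
  obtain ⟨C, c, hC, hc, h⟩ := stub_diamondStaircase (stub_doublingUpgrade stub_wedgeSlabFloor)
  refine ⟨C, c, hc, fun u v ℓ hℓ hd => ?_⟩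
  obtain ⟨N, hN⟩ := h u v
  refine ⟨N, le_trans ?_ (le_trans hN ?_)⟩
  · -- `c ℓ^{-C} ≤ c (max 1 d)^{-C}` since `1 ≤ max 1 d ≤ ℓ` and `-C ≤ 0`
    refine mul_le_mul_of_nonneg_left ?_ hc.le
    exact Real.rpow_le_rpow_of_nonpos (lt_of_lt_of_le zero_lt_one (le_max_left _ _))
      (max_le hℓ hd) (neg_nonpos.2 hC)
  · -- the `(d/10+2)`-tube family is contained in the `(ℓ/10+2)`-tube family
    refine Finset.sum_le_sum fun n _ => ?_
    refine Finset.sum_le_sum_of_subset_of_nonneg ?_ fun _ _ _ =>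
      pow_nonneg criticalFugacity_pos.le _
    refine Finset.monotone_filter_right _ fun ω _ hω => ?_
    intro i hi
    exact (hω i hi).trans (by linarith)

end Summit.CriticalPhenomena.SAWScalingLimit.Cruxes.TubeLowerBound.BridgeDoublingTower
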